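import Summits.Parity.GeneralizedHardyLittlewood.Theorems.PrimeLevelFamEdgeMomentsBeyondDiagonalDiagDecorLogShiftEngines
import Mathlib.Data.Nat.Choose.Sum
import HarnessLib

/-!
# Route `PrimeLevelFamEdge`, crux K_A `MomentsBeyondDiagonal` (stmt-Parity-20007), line «petersson_layers» v4, stub `stub_diag`:
# **the `(log k)^σ·τ_{1,1}(k)`-decorated profile coordinate has NO main term: it is `O(D(n)(1+κ(n))·log^σM/log M)`** (`σ ≥ 1`)

Census R3(ii), ANALYTIC HALF — first instantiation of the generic shift machinery of `…DiagDecorLogShiftEngines`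
(item 1 of `Cruxes/MomentsBeyondDiagonal/Lines/petersson_layers_stub_diag_g9_decor.md`). For `t = τ_{1,1}` the `k`-engine
is `Σ_{k≤y} W(k)[(k,n)=1]τ_{1,1}(k)logᶜ(y/k) = E_n logᶜy + O(D(1+κ)(1+log y)^{c−1})` (`…DiagDecorTauEngines`, `m_c = 1`,
`s = 0`), so the `(log k)^σ` shift has coefficient `Σ_β C(σ,β)(−1)^β = 0` for `σ ≥ 1` (`Int.alternating_sum_range_choose_of_ne`):

* `abs_copW_tau11_logPow_sum_le` — **`|Σ_{k≤y} W(k)[(k,n)=1]τ_{1,1}(k)(log k)^σ logᶜ(y/k)| ≤ C·D(n)(1+κ(n))(1+log y)^{σ+c}/(1+log y)`**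
  (`σ ≥ 1`, `c ≥ 2`);
* `abs_decorProfile_tau11_logPow_le` — **`|Σ_c P_c(Σ_{k≤M/n} W[(k,n)=1]τ_{1,1}(k)(log k)^σ logᶜ((M/n)/k))/logᶜM| ≤
  C·D(n)(1+κ(n))·log^σM/log M`** (`P₀ = P₁ = 0`, `M ≥ 3`, `1 ≤ n ≤ M`): the crude-size input (`A(M) = log^σM/log M`) of
  `…DiagDecorCrudeMonomial.abs_selbergMonomial_crude_kappa_le` — every monomial `(log k₁)^σ τ_{1,1}(k₁)·t₂(k₂)` of the
  order-`(1,1)` weight is one logarithm below its formal degree.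

Def-free; theorems only. Helper `--supports stmt-Parity-20007`; closes nothing; K_A, K_B and the Parity summit are NOT proved;
nothing about Landau–Siegel zeros.

## References
* E. Kowalski, P. Michel, J. VanderKam, J. reine angew. Math. 526 (2000), (23)–(28) pp. 13–15.
  [cite: KowalskiMichelVanderKam2000, (23)–(28) — derivation (log k powers of the τ₁₁-decoration)]
-/

noncomputable section

open scoped Real ArithmeticFunction.Moebius
open Finset ArithmeticFunction Polynomial

namespace Summit.Parity.GeneralizedHardyLittlewood.Theorems.MomentsBeyondDiagonal.DiagKernel

open Literature.NumberTheory.LFunctions Literature.NumberTheory.LFunctions.KMV2000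
open MollifierMainTerm (W)
open SelbergCoord (kappa)
open Literature.NumberTheory.Sieve (one_le_log_of_three_le)
open Summit.Parity.GeneralizedHardyLittlewood.Theorems.BeyondDiagonalBeatsQuarter.KernelFormXSq
  (mainConst divWeight divWeight_nonneg mainConst_nonneg)

/-- `Σ_{β≤σ} C(σ,β)(−1)^β·1 = 0` in `ℝ` for `σ ≥ 1`. [folklore] -/
theorem sum_choose_mul_neg_one_pow_mul_one_eq_zero {σ : ℕ} (hσ : 1 ≤ σ) :
    ∑ β ∈ Finset.range (σ + 1), (σ.choose β : ℝ) * (-1) ^ β * (1 : ℝ) = 0 := by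
  have h := Int.alternating_sum_range_choose_of_ne (show σ ≠ 0 by omega)
  have h' : ((∑ m ∈ Finset.range (σ + 1), ((-1) ^ m * (σ.choose m : ℤ)) : ℤ) : ℝ) = 0 := by rw [h]; simp
  push_cast at h'
  rw [← h']
  exact Finset.sum_congr rfl fun β _ ↦ by ring

/-- **The `(log k)^σ τ_{1,1}`-decorated coprime Selberg sum has no main term** (`σ ≥ 1`, `c ≥ 2`):
`|Σ_{k≤y} W(k)[(k,n)=1]τ_{1,1}(k)(log k)^σ logᶜ(y/k)| ≤ C·D(n)(1+κ(n))(1+log y)^{σ+c}/(1+log y)`.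
[cite: KowalskiMichelVanderKam2000, (23)–(28) — derivation] -/
theorem abs_copW_tau11_logPow_sum_le {σ : ℕ} (hσ : 1 ≤ σ) {c : ℕ} (hc : 2 ≤ c) :
    ∃ C : ℝ, 0 < C ∧ ∀ n : ℕ, n ≠ 0 → ∀ y : ℝ, 1 ≤ y →
      |∑ k ∈ Icc 1 ⌊y⌋₊, (if k.Coprime n then W k else 0) *
          (∑ d ∈ k.divisors, Real.log d * Real.log ((k / d : ℕ) : ℝ)) * Real.log k ^ σ * Real.log (y / k) ^ c| ≤
        C * divWeight n * (1 + kappa n) * (1 + Real.log y) ^ (σ + c) / (1 + Real.log y) := by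
  obtain ⟨C, hC, h⟩ := abs_kSum_logPow_shift_sub_le
    (fun n k ↦ (if k.Coprime n then W k else 0) * (∑ d ∈ k.divisors, Real.log d * Real.log ((k / d : ℕ) : ℝ)))
    (fun _ ↦ (1 : ℝ)) (zero_le_one : 0 ≤ 1)
    (fun c' hc' ↦ by
      obtain ⟨K, hK, hK'⟩ := abs_copW_tau11_sum_sub_le hc'
      refine ⟨K, hK, fun n hn y hy ↦ ?_⟩
      simpa using hK' n hn y hy) σ hc
  refine ⟨C, hC, fun n hn y hy ↦ ?_⟩
  have h' := h n hn y hy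
  rw [sum_choose_mul_neg_one_pow_mul_one_eq_zero hσ, zero_mul, zero_mul, sub_zero, Nat.sub_zero] at h'
  exact h'

/-- **The `(log k)^σ τ_{1,1}`-decorated profile coordinate is `O(D(n)(1+κ(n))·log^σM/log M)`** (`σ ≥ 1`, `P₀ = P₁ = 0`,
`M ≥ 3`, `1 ≤ n ≤ M`). [cite: KowalskiMichelVanderKam2000, (23)–(28) — derivation] -/
theorem abs_decorProfile_tau11_logPow_le {σ : ℕ} (hσ : 1 ≤ σ) (P : ℝ[X]) (hP0 : P.coeff 0 = 0) (hP1 : P.coeff 1 = 0) :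
    ∃ C : ℝ, 0 < C ∧ ∀ M : ℝ, 3 ≤ M → ∀ n : ℕ, n ≠ 0 → (n : ℝ) ≤ M →
      |∑ c ∈ Finset.range (P.natDegree + 1), P.coeff c *
          ((∑ k ∈ Icc 1 ⌊M / n⌋₊, (if k.Coprime n then W k else 0) *
              (∑ d ∈ k.divisors, Real.log d * Real.log ((k / d : ℕ) : ℝ)) * Real.log k ^ σ *
              Real.log (M / n / k) ^ c) / Real.log M ^ c)| ≤
        C * divWeight n * (1 + kappa n) * Real.log M ^ σ / Real.log M := by
  obtain ⟨C, hC, h⟩ := abs_profileLayer_shift_sub_le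
    (fun n y c ↦ ∑ k ∈ Icc 1 ⌊y⌋₊, (if k.Coprime n then W k else 0) *
      (∑ d ∈ k.divisors, Real.log d * Real.log ((k / d : ℕ) : ℝ)) * Real.log k ^ σ * Real.log (y / k) ^ c)
    (fun _ ↦ (0 : ℝ)) σ (zero_le_one : 0 ≤ 1)
    (fun c hc ↦ by
      obtain ⟨K, hK, hK'⟩ := abs_copW_tau11_logPow_sum_le hσ hc
      refine ⟨K, hK, fun n hn y hy ↦ ?_⟩
      simpa using hK' n hn y hy) P hP0 hP1
  refine ⟨C, hC, fun M hM n hn hnM ↦ ?_⟩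
  have h' := h M hM n hn hnM
  simp only [zero_mul, zero_div, mul_zero, Finset.sum_const_zero, sub_zero, zero_add, pow_one] at h'
  exact h'

end Summit.Parity.GeneralizedHardyLittlewood.Theorems.MomentsBeyondDiagonal.DiagKernel

end
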